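import Literature.Geometry.Lorentzian.KerrDeSitter
import Literature.Geometry.Lorentzian.KerrConvergence
import HarnessLib

/-!
# The Kerr–de Sitter reference background

Definition request `defn-KerrDeSitterBackground` of route `FinalStateConjecture/LambdaRegulator`
(items `UniformKdSCapture`, `PunctureTheorem`): the Kerr–de Sitter family `g_{M,a,Λ}` packaged as
a reference background `KerrDeSitter.background M a Λ r₀ : ModelBackground` for the
asymptotic-stability vocabulary of `KerrConvergence.lean` (`Spacetime.ConvergesTo`,
`Spacetime.RemainsCloseTo`, late charts, slabs `{t* = τ}` and truncated slabs `{t* = τ, r ≤ R}`),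
beside `Kerr.background`, `Minkowski.background` and `boostedKerrBackground`.

The metric components are those of `KerrDeSitter.lean` (`KerrDeSitter.bilin M a Λ`): Carter's
metric in the Cartesian star-coordinates `(t*, x, y, z)` of Hintz–Vasy (Acta Math. 220 (2018),
§3.2) and Petersen–Vasy (arXiv:2112.01355, §1.1), regular across the future event horizon AND the
future cosmological horizon, on the oblate-spheroidal shell `Kerr.region a r₀ = {r > max r₀ 0}`
of `E4` (`r = Kerr.radius a`, the Kerr–Schild radius), with time function `t* = x⁰` and radius `r`;
at `Λ = 0` that chart is the ingoing Kerr–Schild chart (`KerrDeSitter.bilin_zero_lambda`). Hence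
"static-patch convergence to `KdS(M, a, Λ)`" is `Spacetime.ConvergesTo (KerrDeSitter.background
M a Λ r₀)` (`Spacetime.ConvergesToKerrDeSitter`), and for `Λ = 0`, `r₀ = r₊` it is literally
`Spacetime.ConvergesToKerr` (`convergesToKerrDeSitter_zero_lambda_iff`).

## Contents

* generic congruence lemmas (namespace `Spacetime`): two reference backgrounds with the same
  domain, time and radius functions whose metric components agree ON the domain have the same
  deviations, late embeddings, `ConvergesTo` and `RemainsCloseTo`
  (`deviation_congr_bilin`, `deviationCk_congr_bilin`, `truncDeviationCk_congr_bilin`,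
  `isLateChart_congr_bilin`, `isLateEmbedding_congr_bilin`, `convergesTo_congr_bilin`,
  `remainsCloseTo_congr_bilin`) — the values of `ModelBackground.bilin` off the domain are junk;
* `KerrDeSitter.background`, `KerrDeSitter.lateRegion`, `KerrDeSitter.timeSlab` and their
  membership lemmas, `KerrDeSitter.background_bilin_eq_kerr_bilin` (`Λ = 0` on the domain);
* `Spacetime.ConvergesToKerrDeSitter`, `Spacetime.RemainsCloseToKerrDeSitter` and their `Λ = 0`
  identifications with `ConvergesToKerr` / `RemainsCloseToKerr` (inner cut `r₊`) and with the Kerr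
  background on a general shell `Kerr.region a r₀` (horizon-penetrating inner cut).

## Design choices

* The inner cut `r₀` is a parameter, as for `Kerr.region`/`KerrDeSitter.spacetime`: Hintz–Vasy
  work on `{r₊ − 3ε < r < r_c + 3ε}` (in their notation `r_{b,−} = r₊`, `r_{b,+} = r_c`), the
  requesting items on `{t* = 0, r > r₀}` with `r₀` slightly below `r₊`; the outer region
  `{r > r_c}` (expanding region) is included and is cut off by truncated slabs where needed.
  The horizon radii themselves are `KerrDeSitter.rPlus/rCosmo` (roots of a quartic).
* No regularity hypothesis (`KerrDeSitter.IsRegular`) is built into the background: a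
  `ModelBackground` is plain data (as `Kerr.background` carries no `0 ≤ M`); statements quantify
  over regular/subextremal parameters explicitly.
* Parameters are `(M, a, Λ)` as in `KerrDeSitter.lean`; the requesting route writes `Λ = 3H²`.

## References

* P. Hintz, A. Vasy, *The global non-linear stability of the Kerr–de Sitter family of black
  holes*, Acta Math. 220 (2018) 1–206, Thm. 1.1, §3.2.
* O. Petersen, A. Vasy, *Wave equations in the Kerr–de Sitter spacetime: the full subextremal
  range*, arXiv:2112.01355, §1.1.
* M. Dafermos, G. Holzegel, I. Rodnianski, M. Taylor, arXiv:2104.08222, §1 (consequence form of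
  asymptotic stability, see `KerrConvergence.lean`).
-/

noncomputable section

open TopologicalSpace Filter
open scoped ENNReal Topology

universe u

namespace Literature.Geometry.Lorentzian

/-! ### Backgrounds whose metric components agree on the domain -/

namespace Spacetime

variable (𝓢 : Spacetime.{u} 4) {U : Opens E4} {b b' : E4 → E4 →L[ℝ] E4 →L[ℝ] ℝ}

/-- Two reference backgrounds with the same domain, time and radius functions whose metric
components agree on the domain have the same metric deviation `Ψ^* g − g₀` (the values of
`ModelBackground.bilin` off the domain are never used; DHRT arXiv:2104.08222, §1).
[cite: arXiv210408222, §1] -/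
theorem deviation_congr_bilin (t r : E4 → ℝ) (h : ∀ x ∈ U, b x = b' x) (Ψ : U → 𝓢.carrier)
    (x : U) : 𝓢.deviation ⟨U, b, t, r⟩ Ψ x = 𝓢.deviation ⟨U, b', t, r⟩ Ψ x := by
  simp only [Spacetime.deviation, h x.1 x.2]

/-- Backgrounds agreeing on the domain have the same `Cᵏ` deviation on every slab
(DHRT arXiv:2104.08222, §1). [cite: arXiv210408222, §1] -/
theorem deviationCk_congr_bilin (t r : E4 → ℝ) (h : ∀ x ∈ U, b x = b' x) (Ψ : U → 𝓢.carrier)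
    (k : ℕ) (τ : ℝ) : 𝓢.deviationCk ⟨U, b, t, r⟩ Ψ k τ = 𝓢.deviationCk ⟨U, b', t, r⟩ Ψ k τ := by
  have hdev : 𝓢.deviation ⟨U, b, t, r⟩ Ψ = 𝓢.deviation ⟨U, b', t, r⟩ Ψ :=
    funext fun x ↦ 𝓢.deviation_congr_bilin t r h Ψ x
  simp only [Spacetime.deviationCk, Spacetime.deviationExtend, ModelBackground.timeSlab, hdev]

/-- Backgrounds agreeing on the domain have the same `Cᵏ` deviation on every truncated slab
(DHRT arXiv:2104.08222, §1). [cite: arXiv210408222, §1] -/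
theorem truncDeviationCk_congr_bilin (t r : E4 → ℝ) (h : ∀ x ∈ U, b x = b' x)
    (Ψ : U → 𝓢.carrier) (k : ℕ) (R τ : ℝ) :
    𝓢.truncDeviationCk ⟨U, b, t, r⟩ Ψ k R τ = 𝓢.truncDeviationCk ⟨U, b', t, r⟩ Ψ k R τ := by
  have hdev : 𝓢.deviation ⟨U, b, t, r⟩ Ψ = 𝓢.deviation ⟨U, b', t, r⟩ Ψ :=
    funext fun x ↦ 𝓢.deviation_congr_bilin t r h Ψ x
  simp only [Spacetime.truncDeviationCk, Spacetime.deviationExtend, ModelBackground.truncTimeSlab,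
    hdev]

/-- Being a late-time chart does not involve the reference metric (DHRT arXiv:2104.08222, §1). [cite: arXiv210408222, §1] -/
theorem isLateChart_congr_bilin (t r : E4 → ℝ) (𝒟 : Set 𝓢.carrier) (τ₀ : ℝ)
    (Ψ : U → 𝓢.carrier) :
    𝓢.IsLateChart ⟨U, b, t, r⟩ 𝒟 τ₀ Ψ ↔ 𝓢.IsLateChart ⟨U, b', t, r⟩ 𝒟 τ₀ Ψ := by
  constructor
  · rintro ⟨h1, h2, h3⟩
    exact ⟨h1, h2, h3⟩
  · rintro ⟨h1, h2, h3⟩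
    exact ⟨h1, h2, h3⟩

/-- Being a late-time embedding does not involve the reference metric (DHRT arXiv:2104.08222,
§1). [cite: arXiv210408222, §1] -/
theorem isLateEmbedding_congr_bilin (t r : E4 → ℝ) (𝒟 : Set 𝓢.carrier) (τ₀ : ℝ)
    (Ψ : U → 𝓢.carrier) :
    𝓢.IsLateEmbedding ⟨U, b, t, r⟩ 𝒟 τ₀ Ψ ↔ 𝓢.IsLateEmbedding ⟨U, b', t, r⟩ 𝒟 τ₀ Ψ := by
  constructor
  · rintro ⟨h1, h2⟩
    exact ⟨(𝓢.isLateChart_congr_bilin t r 𝒟 τ₀ Ψ).1 h1, h2⟩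
  · rintro ⟨h1, h2⟩
    exact ⟨(𝓢.isLateChart_congr_bilin t r 𝒟 τ₀ Ψ).2 h1, h2⟩

/-- **Convergence is insensitive to the reference metric off the domain**: two backgrounds with the
same domain, time and radius functions whose metric components agree on the domain define the
same notion `ConvergesTo` (DHRT arXiv:2104.08222, §1). [cite: arXiv210408222, §1] -/
theorem convergesTo_congr_bilin (t r : E4 → ℝ) (h : ∀ x ∈ U, b x = b' x) (𝒟 : Set 𝓢.carrier)
    (k : ℕ) : 𝓢.ConvergesTo ⟨U, b, t, r⟩ 𝒟 k ↔ 𝓢.ConvergesTo ⟨U, b', t, r⟩ 𝒟 k := by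
  constructor
  · rintro ⟨τ₀, Ψ, hΨ, ht⟩
    refine ⟨τ₀, Ψ, (𝓢.isLateEmbedding_congr_bilin t r 𝒟 τ₀ Ψ).1 hΨ, ?_⟩
    simpa only [𝓢.deviationCk_congr_bilin t r h] using ht
  · rintro ⟨τ₀, Ψ, hΨ, ht⟩
    refine ⟨τ₀, Ψ, (𝓢.isLateEmbedding_congr_bilin t r 𝒟 τ₀ Ψ).2 hΨ, ?_⟩
    simpa only [𝓢.deviationCk_congr_bilin t r h] using ht

/-- `ε`-closeness is insensitive to the reference metric off the domain (DHRT arXiv:2104.08222,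
§1). [cite: arXiv210408222, §1] -/
theorem remainsCloseTo_congr_bilin (t r : E4 → ℝ) (h : ∀ x ∈ U, b x = b' x)
    (𝒟 : Set 𝓢.carrier) (k : ℕ) (ε : ℝ≥0∞) :
    𝓢.RemainsCloseTo ⟨U, b, t, r⟩ 𝒟 k ε ↔ 𝓢.RemainsCloseTo ⟨U, b', t, r⟩ 𝒟 k ε := by
  constructor
  · rintro ⟨τ₀, Ψ, hΨ, hb⟩
    refine ⟨τ₀, Ψ, (𝓢.isLateEmbedding_congr_bilin t r 𝒟 τ₀ Ψ).1 hΨ, ?_⟩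
    simpa only [𝓢.deviationCk_congr_bilin t r h] using hb
  · rintro ⟨τ₀, Ψ, hΨ, hb⟩
    refine ⟨τ₀, Ψ, (𝓢.isLateEmbedding_congr_bilin t r 𝒟 τ₀ Ψ).2 hΨ, ?_⟩
    simpa only [𝓢.deviationCk_congr_bilin t r h] using hb

end Spacetime

/-! ### The Kerr–de Sitter background -/

namespace KerrDeSitter

/-- **The Kerr–de Sitter reference background** `KdS(M, a, Λ)` with inner cut `r₀`: domain the
star-chart shell `Kerr.region a r₀ = {x ∈ E4 | max r₀ 0 < r(a, x)}` (for subextremal parameters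
and `r₋ < r₀ < r₊` it contains a neighbourhood of `[r₊, r_c]` and the expanding region beyond
`r_c`; Hintz–Vasy take `r₀ = r₊ − 3ε`), reference metric the Kerr–de Sitter components
`KerrDeSitter.bilin M a Λ` of `KerrDeSitter.lean` (regular across the future event horizon and the
future cosmological horizon), time function `t* = x⁰` (slabs `{t* = τ}`), radius the spheroidal
Kerr–Schild radius `Kerr.radius a` (truncated slabs `{t* = τ, r ≤ R}`). It is the background of the
bundled spacetime `KerrDeSitter.spacetime M a Λ r₀ h` (same carrier, same components); for
`Λ = 0` it agrees with the Kerr–Schild Kerr background on the domain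
(`background_bilin_eq_kerr_bilin`, `Spacetime.convergesToKerrDeSitter_zero_lambda_iff`).
Hintz–Vasy 2018, Thm. 1.1 and §3.2 (`M° = ℝ_{t*} × X`, decay measured along `t*`).
[cite: HintzVasy2018, §3.2] -/
def background (M a Λ r₀ : ℝ) : ModelBackground where
  domain := Kerr.region a r₀
  bilin := bilin M a Λ
  time x := x 0
  radius := Kerr.radius a

/-- The domain of the Kerr–de Sitter background is the chart shell `Kerr.region a r₀`
(Hintz–Vasy 2018, §3.2). [cite: HintzVasy2018, §3.2] -/
@[simp]
theorem background_domain (M a Λ r₀ : ℝ) : (background M a Λ r₀).domain = Kerr.region a r₀ := rfl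

/-- The reference metric of the Kerr–de Sitter background is `KerrDeSitter.bilin M a Λ`
(Hintz–Vasy 2018, §3.2). [cite: HintzVasy2018, §3.2] -/
@[simp]
theorem background_bilin (M a Λ r₀ : ℝ) : (background M a Λ r₀).bilin = bilin M a Λ := rfl

/-- The time function of the Kerr–de Sitter background is `t* = x⁰` (Hintz–Vasy 2018, §3.2). [cite: HintzVasy2018, §3.2] -/
@[simp]
theorem background_time (M a Λ r₀ : ℝ) (x : E4) : (background M a Λ r₀).time x = x 0 := rfl

/-- The radius function of the Kerr–de Sitter background is the Kerr–Schild radius `Kerr.radius a`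
(Hintz–Vasy 2018, §3.2; Visser arXiv:0706.0622, (35)). [cite: HintzVasy2018, §3.2] -/
@[simp]
theorem background_radius (M a Λ r₀ : ℝ) : (background M a Λ r₀).radius = Kerr.radius a := rfl

/-- The carrier of the bundled Kerr–de Sitter spacetime is the domain of the background
(Hintz–Vasy 2018, §3.2). [cite: HintzVasy2018, §3.2] -/
theorem spacetime_carrier_eq_background_domain [Kerr.Facts] [Facts] (M a Λ r₀ : ℝ)
    (h : IsRegular M a Λ r₀) :
    (spacetime M a Λ r₀ h).carrier = (background M a Λ r₀).domain := rfl

/-- The **late region** `{x ∈ Kerr.region a r₀ | τ₀ < t*(x)}` of the Kerr–de Sitter background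
(Hintz–Vasy 2018, Thm. 1.1: the region `{t* ≥ 0}` of `M°`). [cite: HintzVasy2018, Thm. 1.1] -/
def lateRegion (M a Λ r₀ τ₀ : ℝ) : Set (Kerr.region a r₀) := (background M a Λ r₀).lateRegion τ₀

/-- The **time slab** `{x ∈ Kerr.region a r₀ | t*(x) = τ}` of the Kerr–de Sitter background
(Hintz–Vasy 2018, §3.2: the level sets of `t*`). [cite: HintzVasy2018, §3.2] -/
def timeSlab (M a Λ r₀ τ : ℝ) : Set (Kerr.region a r₀) := (background M a Λ r₀).timeSlab τ

/-- Membership in the Kerr–de Sitter late region (Hintz–Vasy 2018, Thm. 1.1). [cite: HintzVasy2018, Thm. 1.1] -/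
@[simp]
theorem mem_lateRegion {M a Λ r₀ τ₀ : ℝ} {x : Kerr.region a r₀} :
    x ∈ lateRegion M a Λ r₀ τ₀ ↔ τ₀ < x.1 0 :=
  Iff.rfl

/-- Membership in a Kerr–de Sitter time slab (Hintz–Vasy 2018, §3.2). [cite: HintzVasy2018, §3.2] -/
@[simp]
theorem mem_timeSlab {M a Λ r₀ τ : ℝ} {x : Kerr.region a r₀} :
    x ∈ timeSlab M a Λ r₀ τ ↔ x.1 0 = τ :=
  Iff.rfl

/-- **`Λ = 0`**: on its domain the Kerr–de Sitter background with `Λ = 0` has the metric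
components of the Kerr–Schild Kerr chart, `KerrDeSitter.bilin M a 0 x = Kerr.bilin M a x` for
`x ∈ Kerr.region a r₀` (`KerrDeSitter.bilin_zero_lambda`; Dafermos–Rodnianski arXiv:0811.0354,
§5.1). [cite: arXiv08110354, §5.1] -/
theorem background_bilin_eq_kerr_bilin (M a r₀ : ℝ) {x : E4} (hx : x ∈ Kerr.region a r₀) :
    (background M a 0 r₀).bilin x = Kerr.bilin M a x :=
  bilin_zero_lambda M a (Kerr.radius_pos_of_mem_region hx)

end KerrDeSitter

/-! ### Convergence to Kerr–de Sitter -/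

namespace Spacetime

variable (𝓢 : Spacetime.{u} 4)

/-- **Convergence to the Kerr–de Sitter solution `KdS(M, a, Λ)` in the region `𝒟`, in `Cᵏ`**
("static-patch convergence"), in the star-chart gauge of `KerrDeSitter.background M a Λ r₀` with
inner cut `r₀`: `ConvergesTo` for that background, i.e. a late-time embedding of the late shell
`{t* > τ₀, r > max r₀ 0}` in which the `Cᵏ` sup deviation of `Ψ^* g` from `g_{M,a,Λ}` over the
slabs `{t* = τ}` tends to `0`. Consequence-form paraphrase (see `KerrConvergence.lean`) of
Hintz–Vasy 2018, Thm. 1.1 (`g − g_b = O(e^{−α t*})` on `{r₊ − ε < r < r_c + ε}`; Fang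
arXiv:2112.07183). [cite: HintzVasy2018, Thm. 1.1] -/
def ConvergesToKerrDeSitter (𝒟 : Set 𝓢.carrier) (M a Λ r₀ : ℝ) (k : ℕ) : Prop :=
  𝓢.ConvergesTo (KerrDeSitter.background M a Λ r₀) 𝒟 k

/-- **`ε`-closeness to `KdS(M, a, Λ)` in `𝒟`, in `Cᵏ`** (orbital stability in the star-chart
gauge): `RemainsCloseTo` for `KerrDeSitter.background M a Λ r₀` (Hintz–Vasy 2018, Thm. 1.1).
[cite: HintzVasy2018, Thm. 1.1] -/
def RemainsCloseToKerrDeSitter (𝒟 : Set 𝓢.carrier) (M a Λ r₀ : ℝ) (k : ℕ) (ε : ℝ≥0∞) : Prop :=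
  𝓢.RemainsCloseTo (KerrDeSitter.background M a Λ r₀) 𝒟 k ε

/-- **`Λ = 0`, general inner cut**: convergence to `KdS(M, a, 0)` on the shell `Kerr.region a r₀`
is convergence to the Kerr–Schild Kerr background on the same (horizon-penetrating if `r₀ < r₊`)
shell (DHRT arXiv:2104.08222, §1; `KerrDeSitter.bilin_zero_lambda`). [cite: arXiv210408222, §1] -/
theorem convergesToKerrDeSitter_zero_lambda_iff' (𝒟 : Set 𝓢.carrier) (M a r₀ : ℝ) (k : ℕ) :
    𝓢.ConvergesToKerrDeSitter 𝒟 M a 0 r₀ k ↔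
      𝓢.ConvergesTo ⟨Kerr.region a r₀, Kerr.bilin M a, fun x ↦ x 0, Kerr.radius a⟩ 𝒟 k :=
  𝓢.convergesTo_congr_bilin _ _ (fun _ hx ↦ KerrDeSitter.background_bilin_eq_kerr_bilin M a r₀ hx)
    𝒟 k

/-- **`Λ = 0`, inner cut `r₊`**: convergence to `KdS(M, a, 0)` with inner cut `Kerr.rPlus M a` is
literally `ConvergesToKerr 𝒟 M a k` (DHRT arXiv:2104.08222, §1). [cite: arXiv210408222, §1] -/
theorem convergesToKerrDeSitter_zero_lambda_iff (𝒟 : Set 𝓢.carrier) (M a : ℝ) (k : ℕ) :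
    𝓢.ConvergesToKerrDeSitter 𝒟 M a 0 (Kerr.rPlus M a) k ↔ 𝓢.ConvergesToKerr 𝒟 M a k :=
  𝓢.convergesToKerrDeSitter_zero_lambda_iff' 𝒟 M a (Kerr.rPlus M a) k

/-- **`Λ = 0`, general inner cut**: `ε`-closeness to `KdS(M, a, 0)` on `Kerr.region a r₀` is
`ε`-closeness to the Kerr–Schild Kerr background on that shell (DHRT arXiv:2104.08222, §1). [cite: arXiv210408222, §1] -/
theorem remainsCloseToKerrDeSitter_zero_lambda_iff' (𝒟 : Set 𝓢.carrier) (M a r₀ : ℝ) (k : ℕ)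
    (ε : ℝ≥0∞) :
    𝓢.RemainsCloseToKerrDeSitter 𝒟 M a 0 r₀ k ε ↔
      𝓢.RemainsCloseTo ⟨Kerr.region a r₀, Kerr.bilin M a, fun x ↦ x 0, Kerr.radius a⟩ 𝒟 k ε :=
  𝓢.remainsCloseTo_congr_bilin _ _
    (fun _ hx ↦ KerrDeSitter.background_bilin_eq_kerr_bilin M a r₀ hx) 𝒟 k ε

/-- **`Λ = 0`, inner cut `r₊`**: `ε`-closeness to `KdS(M, a, 0)` with inner cut `Kerr.rPlus M a` is
literally `RemainsCloseToKerr 𝒟 M a k ε` (DHRT arXiv:2104.08222, §1). [cite: arXiv210408222, §1] -/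
theorem remainsCloseToKerrDeSitter_zero_lambda_iff (𝒟 : Set 𝓢.carrier) (M a : ℝ) (k : ℕ)
    (ε : ℝ≥0∞) :
    𝓢.RemainsCloseToKerrDeSitter 𝒟 M a 0 (Kerr.rPlus M a) k ε ↔ 𝓢.RemainsCloseToKerr 𝒟 M a k ε :=
  𝓢.remainsCloseToKerrDeSitter_zero_lambda_iff' 𝒟 M a (Kerr.rPlus M a) k ε

/-- Convergence to Kerr–de Sitter in `Cᵏ'` implies convergence in `Cᵏ` for `k ≤ k'`
(DHRT arXiv:2104.08222, §1). [cite: arXiv210408222, §1] -/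
theorem ConvergesToKerrDeSitter.of_le {𝓢 : Spacetime.{u} 4} {𝒟 : Set 𝓢.carrier}
    {M a Λ r₀ : ℝ} {k k' : ℕ} (h : 𝓢.ConvergesToKerrDeSitter 𝒟 M a Λ r₀ k') (hk : k ≤ k') :
    𝓢.ConvergesToKerrDeSitter 𝒟 M a Λ r₀ k :=
  Spacetime.ConvergesTo.of_le h hk

/-- Convergence to Kerr–de Sitter gives near-zone convergence on every truncated slab
`{t* = τ, r ≤ R}` in the same chart (the form used with several black holes; DHRT
arXiv:2104.08222, §1). [cite: arXiv210408222, §1] -/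
theorem ConvergesToKerrDeSitter.exists_tendsto_truncDeviationCk {𝓢 : Spacetime.{u} 4}
    {𝒟 : Set 𝓢.carrier} {M a Λ r₀ : ℝ} {k : ℕ} (h : 𝓢.ConvergesToKerrDeSitter 𝒟 M a Λ r₀ k) :
    ∃ (τ₀ : ℝ) (Ψ : Kerr.region a r₀ → 𝓢.carrier),
      𝓢.IsLateEmbedding (KerrDeSitter.background M a Λ r₀) 𝒟 τ₀ Ψ ∧
        ∀ R, Tendsto (fun τ ↦ 𝓢.truncDeviationCk (KerrDeSitter.background M a Λ r₀) Ψ k R τ)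
          atTop (𝓝 0) :=
  Spacetime.ConvergesTo.exists_tendsto_truncDeviationCk h

end Spacetime

end Literature.Geometry.Lorentzian

end
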